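import Literature.Barriers.KontsevichZagierPeriods.GrothendieckPeriodConjectureDependence
import Literature.NumberTheory.EllipticCurves.RealLatticePeriod
import Literature.NumberTheory.EllipticCurves.LatticeJInvariant
import Literature.NumberTheory.Transcendental.MasserLemma22
import Literature.NumberTheory.Transcendental.GelfondExpLogConjectureProofs

/-!
# `LadderClimb34` (stmt-KontsevichZagierPeriods-19268) — negative knowledge I:
load-bearing analysis of the consequent

Route `EllipticPeriodsTrdegThree`. The crux is `LadderClimb34 := TrdegThree → Rung 4` with
`Rung 4 := ∀ L, IsAlgebraic ℚ L.g₂ → IsAlgebraic ℚ L.g₃ → NonCM L → AlgebraicIndependent ℚ ![ω₁, ω₂, η₁, η₂]`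
(verbatim the body of `Literature.Barriers.KontsevichZagierPeriods.EllipticPeriodsAlgIndep`,
Fresán's Conjecture 10.4). Landed copy of the crux-attack seat's mutation analysis
(refuter-rattack-stmt-KontsevichZagierPeriods-19268-0, `Mutation.lean`); theorems only, no
statement of the tree is changed.

* `exists_hasCM_isAlgebraic` — a CM lattice WITH ALGEBRAIC INVARIANTS exists in the tree's
  vocabulary: the Gaussian lattice `ℤi ⊕ ℤ` (`PeriodPair.ofUpperHalfPlane I`, `g₃ = 0`) rescaled by
  `c⁴ = g₂` to `g₂ ∈ {0, 1}`; every rescaling keeps CM by `i` (`hasCM_mulLeft_gaussian`).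
* `rung4_false_without_nonCM` — hence `NonCM` is LOAD-BEARING in the consequent: with it dropped,
  Rung 4 is false (`not_algebraicIndependent_periods_of_hasCM`).
* `exists_nonCM_isAlgebraic_ω₁`, `rung4_false_without_isAlgebraic` — the algebraicity of `g₂, g₃`
  is LOAD-BEARING too: the lattice `ℤ ⊕ ℤπi` has no CM (`ω₂/ω₁ = πi` is transcendental — tree
  `Literature.NumberTheory.Transcendental.transcendental_pi_mul_I`, Lindemann — whereas CM forces
  `ω₂/ω₁` algebraic, `isAlgebraic_ω₂_div_ω₁_of_hasCM`) and `ω₁ = 1` is algebraic.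
* Consequently, modulo the sibling crux `TrdegThree` (the antecedent of `LadderClimb34`), the
  ladder step with either hypothesis deleted from its consequent is false
  (`fun h3 h => rung4_false_without_nonCM (h h3)`): a proof of the step must use both. (This file
  deliberately imports only `Literature`, not the route module, so it can be cited from any route
  on `EllipticPeriodsAlgIndep`.)
-/

noncomputable section

namespace Summit.KontsevichZagierPeriods.LadderClimb34Negative

open Complex
open Literature.Barriers.KontsevichZagierPeriods

/-! ## `NonCM` is load-bearing: a CM lattice with algebraic invariants -/

/-- Every rescaling `c·(ℤi ⊕ ℤ)` of the Gaussian lattice has complex multiplication: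
`τ = ω₂/ω₁ = -i` satisfies `1 + τ² = 0` (`Masser1975.hasCM_of_quadratic`). [folklore] -/
theorem hasCM_mulLeft_gaussian (c : ℂ) (hc : c ≠ 0) :
    ((PeriodPair.ofUpperHalfPlane UpperHalfPlane.I).mulLeft c hc).HasCM := by
  refine Literature.NumberTheory.Transcendental.Masser1975.hasCM_of_quadratic _
    (A := 1) (B := 0) (C := 1) (by decide) ?_
  have hτ : ((PeriodPair.ofUpperHalfPlane UpperHalfPlane.I).mulLeft c hc).ω₂ /
      ((PeriodPair.ofUpperHalfPlane UpperHalfPlane.I).mulLeft c hc).ω₁ = -I := by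
    rw [PeriodPair.mulLeft_ω₂, PeriodPair.mulLeft_ω₁, PeriodPair.ofUpperHalfPlane_ω₁,
      PeriodPair.ofUpperHalfPlane_ω₂, UpperHalfPlane.coe_I]
    have hcI : c * I ≠ 0 := mul_ne_zero hc I_ne_zero
    field_simp
    rw [I_sq]; ring
  rw [hτ]
  push_cast
  rw [neg_sq, I_sq]; ring

/-- **A CM lattice with algebraic invariants**: the Gaussian lattice `ℤi ⊕ ℤ` (`g₃ = 0`,
`PeriodPair.g₃_ofUpperHalfPlane_I`) rescaled by a fourth root `c` of `g₂` (so `g₂(cΛ) = c⁻⁴g₂ = 1`;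
if `g₂` were `0`, no rescaling is needed). [folklore] -/
theorem exists_hasCM_isAlgebraic :
    ∃ M : PeriodPair, IsAlgebraic ℚ M.g₂ ∧ IsAlgebraic ℚ M.g₃ ∧ M.HasCM := by
  set L := PeriodPair.ofUpperHalfPlane UpperHalfPlane.I with hL
  have hg₃ : L.g₃ = 0 := PeriodPair.g₃_ofUpperHalfPlane_I
  by_cases hG : L.g₂ = 0
  · refine ⟨L.mulLeft 1 one_ne_zero, ?_, ?_, hasCM_mulLeft_gaussian 1 one_ne_zero⟩
    · rw [PeriodPair.g₂_mulLeft, hG, mul_zero]; exact isAlgebraic_zero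
    · rw [PeriodPair.g₃_mulLeft, hg₃, mul_zero]; exact isAlgebraic_zero
  · set c : ℂ := L.g₂ ^ ((4 : ℕ) : ℂ)⁻¹ with hc
    have hc4 : c ^ 4 = L.g₂ := by rw [hc]; exact Complex.cpow_nat_inv_pow _ (by norm_num)
    have hc0 : c ≠ 0 := by
      intro h0; apply hG; rw [← hc4, h0]; norm_num
    refine ⟨L.mulLeft c hc0, ?_, ?_, hasCM_mulLeft_gaussian c hc0⟩
    · rw [PeriodPair.g₂_mulLeft, hc4, inv_mul_cancel₀ hG]; exact isAlgebraic_one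
    · rw [PeriodPair.g₃_mulLeft, hg₃, mul_zero]; exact isAlgebraic_zero

/-- **`NonCM` is load-bearing in Rung 4** (the consequent of `LadderClimb34`): with `NonCM`
deleted the statement is FALSE — a CM lattice with algebraic invariants has algebraically
dependent periods (`not_algebraicIndependent_periods_of_hasCM`, Fresán §10.3 (10.6)). [folklore] -/
theorem rung4_false_without_nonCM :
    ¬ (∀ L : PeriodPair, IsAlgebraic ℚ L.g₂ → IsAlgebraic ℚ L.g₃ →
        AlgebraicIndependent ℚ ![L.ω₁, L.ω₂, L.η₁, L.η₂]) := by
  intro h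
  obtain ⟨M, h₂, h₃, hCM⟩ := exists_hasCM_isAlgebraic
  exact not_algebraicIndependent_periods_of_hasCM M hCM (h M h₂ h₃)

/-! ## Algebraicity of the invariants is load-bearing: the lattice `ℤ ⊕ ℤπi` -/

/-- **A non-CM lattice with an algebraic period**: `ℤ·1 ⊕ ℤ·πi` has `ω₁ = 1` and no complex
multiplication, since `ω₂/ω₁ = πi` is transcendental whereas a CM lattice has algebraic `ω₂/ω₁`
(`isAlgebraic_ω₂_div_ω₁_of_hasCM`). [folklore] -/
theorem exists_nonCM_isAlgebraic_ω₁ :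
    ∃ L : PeriodPair, NonCM L ∧ IsAlgebraic ℚ L.ω₁ := by
  have hind : LinearIndependent ℝ ![(1 : ℂ), (Real.pi : ℂ) * I] := by
    refine LinearIndependent.pair_iff.mpr fun s t h ↦ ?_
    have h1 := congrArg Complex.re h
    have h2 := congrArg Complex.im h
    simp at h1 h2
    exact ⟨h1, h2⟩
  refine ⟨⟨1, (Real.pi : ℂ) * I, hind⟩, ?_, isAlgebraic_one⟩
  rw [nonCM_iff_not_hasCM]
  intro hCM
  have halg : IsAlgebraic ℚ ((Real.pi : ℂ) * I) := by
    simpa using isAlgebraic_ω₂_div_ω₁_of_hasCM _ hCM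
  exact Literature.NumberTheory.Transcendental.transcendental_pi_mul_I halg

/-- **Algebraicity of `g₂, g₃` is load-bearing in Rung 4** (the consequent of `LadderClimb34`):
with `IsAlgebraic ℚ L.g₂`, `IsAlgebraic ℚ L.g₃` deleted the statement is FALSE at `ℤ ⊕ ℤπi`
(`ω₁ = 1` is algebraic, so the four periods are not algebraically independent). [folklore] -/
theorem rung4_false_without_isAlgebraic :
    ¬ (∀ L : PeriodPair, NonCM L → AlgebraicIndependent ℚ ![L.ω₁, L.ω₂, L.η₁, L.η₂]) := by
  intro h
  obtain ⟨L, hCM, hω₁⟩ := exists_nonCM_isAlgebraic_ω₁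
  exact (h L hCM).transcendental 0 hω₁

end Summit.KontsevichZagierPeriods.LadderClimb34Negative
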